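import Summits.AtomisticToContinuum.Crystallization.Theorems.FrustratedLawDichotomyStrainedPatchHomCoords

/-!
# `(H) HomFloor m` FROM A FINITE LEAF COVER in entry coordinates — the (g3) assembly skeleton, DEF-FREE

Critic rows 765 (g3) / 769 (decomp-a2c hand-1 g19; hand-2 g20 ceded (g3) 09:04Z).  The certificate's root is the set of self-adjoint positive
`U : E3 →L[ℝ] E3` with `‖U − 1‖ ≤ 1/4` (and shuffles `‖ξ‖ ≤ 1/4` for hcp) — `…HomPrunedPolar.homFloor_of_prunedBoxSums_selfAdjoint`; by
`…HomCoords` its ENTRY coordinates `u ij = (U e_j) i` lie in the cube `|u ij − δ ij| ≤ 1/4` (and `ξ ∈ [−1/4, 1/4]³`).  A branch-and-bound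
certificate is a finite family of LEAVES, each a centre/half-width box in these coordinates, such that (COVER) every point of the root cube lies
in some leaf box and (LEAF) on each leaf box the pruned dichotomy holds (prune disjunct from hand-2's `pruneFcc/Hcp_of_*` with leaf data, or the
box floor from `…HomGram.boxSum_ge_of_gramLeaf` / `…HomGramHcp.boxSumHcp_ge_of_gramLeaf` after interval squaring).  This file states that
assembly with leaves as an arbitrary finite indexed family (no `Leaf` structure needed): `homFloor_of_entryCover`.  The COVER hypothesis is
what a bisection tree discharges by structural induction (`…HomBisect.forall_box_of_forall_children`).  Standard axioms; no definitions.
`--supports stmt-AtomisticToContinuum-27623`.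
-/

noncomputable section

namespace Summit.AtomisticToContinuum.Crystallization.Theorems.FrustratedLawDichotomyStrainedPatchHomCover

open scoped BigOperators Classical
open Summit.AtomisticToContinuum.Crystallization.Theorems.ChargedEnergyGapNegative (E3)
open Summit.AtomisticToContinuum.Crystallization.Theorems.FrustratedLawDichotomySchurCut (effPot w₄₅ ω₄)
open Summit.AtomisticToContinuum.Crystallization.Theorems.FrustratedLawDichotomyAveragingRuleTightFree (TightNearCap BadNearCap)
open Summit.AtomisticToContinuum.Crystallization.Theorems.FrustratedLawDichotomyExemptAbsorption (ExemptNear)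
open Summit.AtomisticToContinuum.Crystallization.Theorems.FrustratedLawDichotomyStrainedPatchHomSplit
open Summit.AtomisticToContinuum.Crystallization.Theorems.FrustratedLawDichotomyStrainedPatchHomPrunedPolar
open Summit.AtomisticToContinuum.Crystallization.Theorems.FrustratedLawDichotomyStrainedPatchHomCoords
open Literature.Barriers.AtomisticToContinuum.FlatleyTheil2015 (fccVec)

/-- The root inclusion, packaged: the entries of `U` with `‖U − 1‖ ≤ 1/4` lie in the centre/half-width cube
`|(U e_j) i − δ ij| ≤ 1/4`. [folklore] -/
theorem entries_mem_rootCube {U : E3 →L[ℝ] E3} (hU : ‖U - 1‖ ≤ 1 / 4) (ij : Fin 3 × Fin 3) :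
    |(U (EuclideanSpace.single ij.2 (1 : ℝ))) ij.1 - (if ij.1 = ij.2 then (1 : ℝ) else 0)| ≤ 1 / 4 :=
  abs_entry_sub_le_of_near_one hU ij.1 ij.2

/-- The shuffle's coordinates lie in `[−1/4, 1/4]³`, centre/half-width form. [folklore] -/
theorem shuffle_mem_rootCube {ξ : E3} (hξ : ‖ξ‖ ≤ 1 / 4) (i : Fin 3) : |ξ i - 0| ≤ 1 / 4 := by
  rw [sub_zero, abs_le]; exact coord_mem_cube_of_norm_le hξ i

/-- ★★★ **`HomFloor m` FROM A FINITE LEAF COVER (the (g3) assembly).**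
fcc leaves: index type `ι`, finite family `leaves`, centre `c₀ ℓ` and half-widths `w ℓ` over the 9 entry coordinates `Fin 3 × Fin 3`;
hcp leaves: `ι'`, `leaves'`, boxes over the 12 coordinates `(Fin 3 × Fin 3) ⊕ Fin 3` (entries of `U`, coordinates of `ξ`).
(COVER) every point of the root cube lies in a leaf box; (LEAF) on every leaf box the pruned dichotomy of `homFloor_of_prunedBoxSums_selfAdjoint`
holds for every self-adjoint positive `U` (and `ξ`) whose coordinates lie in the box.  Then `HomFloor m`. [folklore] -/
theorem homFloor_of_entryCover {m : ℝ} {ι ι' : Type*} (leaves : Finset ι) (c₀ w : ι → Fin 3 × Fin 3 → ℝ)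
    (leaves' : Finset ι') (c₀' w' : ι' → (Fin 3 × Fin 3) ⊕ Fin 3 → ℝ)
    (hcover : ∀ u : Fin 3 × Fin 3 → ℝ, (∀ ij, |u ij - (if ij.1 = ij.2 then (1 : ℝ) else 0)| ≤ 1 / 4) →
      ∃ ℓ ∈ leaves, ∀ ij, |u ij - c₀ ℓ ij| ≤ w ℓ ij)
    (hcover' : ∀ u : (Fin 3 × Fin 3) ⊕ Fin 3 → ℝ, (∀ ij : Fin 3 × Fin 3, |u (Sum.inl ij) - (if ij.1 = ij.2 then (1 : ℝ) else 0)| ≤ 1 / 4) →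
      (∀ i : Fin 3, |u (Sum.inr i) - 0| ≤ 1 / 4) → ∃ ℓ ∈ leaves', ∀ k, |u k - c₀' ℓ k| ≤ w' ℓ k)
    (hleaf : ∀ ℓ ∈ leaves, ∀ U : E3 →L[ℝ] E3, (∀ v w : E3, inner ℝ (U v) w = inner ℝ v (U w)) → (∀ w : E3, 0 ≤ inner ℝ w (U w)) →
      ‖U - 1‖ ≤ 1 / 4 → (∀ ij : Fin 3 × Fin 3, |(U (EuclideanSpace.single ij.2 (1 : ℝ))) ij.1 - c₀ ℓ ij| ≤ w ℓ ij) →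
      (∀ (M : ℕ) (z : Fin M → E3) (c : Fin M), Function.Injective z →
          Set.range z = {x : E3 | dist x (z c) ≤ 133 / 10 ∧ ∃ a : Fin 3 → ℤ, x = z c + latPt U fccVec a} →
          TightNearCap (9 / 5) (3 / 2) z c ∨ ExemptNear (9 / 5) ExRec z c ∨ BadNearCap (9 / 5) (3 / 2) z c) ∨
      m ≤ (∑ b ∈ (Fintype.piFinset fun _ : Fin 3 => Finset.Icc (-7 : ℤ) 7).filter (fun b => b ≠ 0),
        effPot w₄₅ ω₄ (3 / 400) ‖latPt U fccVec b‖) / 2 - (-(7175 / 10000) + 3 / 400))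
    (hleaf' : ∀ ℓ ∈ leaves', ∀ (U : E3 →L[ℝ] E3) (ξ : E3), (∀ v w : E3, inner ℝ (U v) w = inner ℝ v (U w)) →
      (∀ w : E3, 0 ≤ inner ℝ w (U w)) → ‖U - 1‖ ≤ 1 / 4 → ‖ξ‖ ≤ 1 / 4 →
      (∀ ij : Fin 3 × Fin 3, |(U (EuclideanSpace.single ij.2 (1 : ℝ))) ij.1 - c₀' ℓ (Sum.inl ij)| ≤ w' ℓ (Sum.inl ij)) →
      (∀ i : Fin 3, |ξ i - c₀' ℓ (Sum.inr i)| ≤ w' ℓ (Sum.inr i)) →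
      (∀ (M : ℕ) (z : Fin M → E3) (c : Fin M), Function.Injective z →
          Set.range z = {x : E3 | dist x (z c) ≤ 133 / 10 ∧ ∃ a : Fin 3 → ℤ,
            x = z c + latPt U hexFrame a ∨ x = z c + latPt U hexFrame a + U (hcpShift + ξ)} →
          TightNearCap (9 / 5) (3 / 2) z c ∨ ExemptNear (9 / 5) ExRec z c ∨ BadNearCap (9 / 5) (3 / 2) z c) ∨
      m ≤ (∑ b ∈ (Fintype.piFinset fun _ : Fin 3 => Finset.Icc (-7 : ℤ) 7).filter (fun b => b ≠ 0),
          effPot w₄₅ ω₄ (3 / 400) ‖latPt U hexFrame b‖ +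
        ∑ b ∈ (Fintype.piFinset fun _ : Fin 3 => Finset.Icc (-7 : ℤ) 7),
          effPot w₄₅ ω₄ (3 / 400) ‖latPt U hexFrame b + U (hcpShift + ξ)‖) / 2 - (-(7175 / 10000) + 3 / 400)) :
    HomFloor m := by
  refine homFloor_of_prunedBoxSums_selfAdjoint (fun U hsa hpos hU1 => ?_) (fun U ξ hsa hpos hU1 hξ => ?_)
  · obtain ⟨ℓ, hℓ, hbox⟩ := hcover (fun ij => (U (EuclideanSpace.single ij.2 (1 : ℝ))) ij.1)
      (fun ij => entries_mem_rootCube hU1 ij)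
    exact hleaf ℓ hℓ U hsa hpos hU1 hbox
  · obtain ⟨ℓ, hℓ, hbox⟩ := hcover'
      (Sum.elim (fun ij : Fin 3 × Fin 3 => (U (EuclideanSpace.single ij.2 (1 : ℝ))) ij.1) (fun i : Fin 3 => ξ i))
      (fun ij => by simpa only [Sum.elim_inl] using entries_mem_rootCube hU1 ij)
      (fun i => by simpa only [Sum.elim_inr] using shuffle_mem_rootCube hξ i)
    exact hleaf' ℓ hℓ U ξ hsa hpos hU1 hξ (fun ij => by simpa only [Sum.elim_inl] using hbox (Sum.inl ij))
      (fun i => by simpa only [Sum.elim_inr] using hbox (Sum.inr i))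

end Summit.AtomisticToContinuum.Crystallization.Theorems.FrustratedLawDichotomyStrainedPatchHomCover

end
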